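import Mathlib

/-!
# A Chebyshev "modulus-squared" polynomial and the two-interval geometry

Helper file for item stmt-QuantumFields-10699 (`MultibosonBridge.AdmissibleRootsExistR`,
route MultibosonBridge, QCD sub-problem). For real weights `w₀, …, w_m` the polynomial

  `Q_w(y) = Σ_{j,k ≤ m} w_j w_k T_{j-k}(y)`   (`T_n` = Chebyshev, `T_{-n} = T_n`)

satisfies `Q_w(cos θ) = |Σ_j w_j e^{ijθ}|²` (`eval_cos_sqPoly`) and
`Q_w(cosh u) = (Σ_j w_j e^{ju}) (Σ_k w_k e^{-ku})` (`eval_cosh_sqPoly`), and has degree `≤ m`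
(`natDegree_sqPoly_le`). With `w_j = b_j ρ^j` this turns the truncated binomial series
`Σ_{j≤m} b_j z^j`, `z = ρ e^{iθ}`, into a polynomial in `y = cos θ`.

The geometry of the substitution `y = (1 + ε - 2s)/(1 - ε)` (`s = x²`), `ρ = (1-√ε)/(1+√ε)`:
`1 - 2ρy + ρ² = 4s/(1+√ε)²` (`one_sub_two_mul_rho`), `‖1 - ρe^{iθ}‖² = 1 - 2ρ cos θ + ρ²`
(`norm_one_sub_rho_exp_sq`) and `(1 - ρe^u)(1 - ρe^{-u}) = 1 - 2ρ cosh u + ρ²`.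

Elementary and definition-free; no named facts. Nothing about QCD or Yang–Mills is proved here.
-/

noncomputable section

open scoped BigOperators ComplexConjugate
open Complex Finset Polynomial

namespace Summit.QuantumFields.QCD.Theorems.MultibosonBridge.AdmissibleRoots

/-! ### The modulus-squared polynomial -/

/-- `Q_w(cos θ) = |Σ_{j ≤ m} w_j e^{ijθ}|²`. -/
theorem eval_cos_sqPoly (w : ℕ → ℝ) (m : ℕ) (θ : ℝ) :
    (∑ j ∈ range (m + 1), ∑ k ∈ range (m + 1),
        C (w j * w k) * Chebyshev.T ℝ ((j : ℤ) - k)).eval (Real.cos θ) =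
      ‖∑ j ∈ range (m + 1), (w j : ℂ) * exp (θ * I) ^ j‖ ^ 2 := by
  set S := ∑ j ∈ range (m + 1), (w j : ℂ) * exp (θ * I) ^ j with hS
  have h1 : (‖S‖ ^ 2 : ℝ) = (S * conj S).re := by
    rw [Complex.mul_conj, Complex.ofReal_re, Complex.normSq_eq_norm_sq]
  rw [h1, hS, sum_mul, Complex.re_sum]
  simp only [eval_finsetSum, eval_mul, eval_C, Polynomial.Chebyshev.T_real_cos]
  refine sum_congr rfl fun j _ => ?_
  rw [map_sum, mul_sum, Complex.re_sum]
  refine sum_congr rfl fun k _ => ?_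
  have hconj : conj ((w k : ℂ) * exp (θ * I) ^ k) = (w k : ℂ) * exp (-(θ * I)) ^ k := by
    rw [map_mul, Complex.conj_ofReal, map_pow, ← Complex.exp_conj, map_mul, Complex.conj_ofReal,
      Complex.conj_I]
    ring_nf
  rw [hconj]
  symm
  have hexp : exp (θ * I) ^ j * exp (-(θ * I)) ^ k = exp ((((j : ℤ) - k : ℤ) : ℝ) * θ * I) := by
    rw [← Complex.exp_nat_mul, ← Complex.exp_nat_mul, ← Complex.exp_add]
    push_cast
    ring_nf
  calc ((w j : ℂ) * exp (θ * I) ^ j * ((w k : ℂ) * exp (-(θ * I)) ^ k)).re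
      = ((w j * w k : ℝ) * exp ((((j : ℤ) - k : ℤ) : ℝ) * θ * I)).re := by
        rw [← hexp]; push_cast; ring_nf
    _ = w j * w k * Real.cos ((((j : ℤ) - k : ℤ) : ℝ) * θ) := by
        rw [Complex.re_ofReal_mul, ← Complex.ofReal_mul, Complex.exp_ofReal_mul_I_re]

/-- `Q_w(cosh u) = (Σ_j w_j e^{ju}) · (Σ_k w_k e^{-ku})`. -/
theorem eval_cosh_sqPoly (w : ℕ → ℝ) (m : ℕ) (u : ℝ) :
    (∑ j ∈ range (m + 1), ∑ k ∈ range (m + 1),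
        C (w j * w k) * Chebyshev.T ℝ ((j : ℤ) - k)).eval (Real.cosh u) =
      (∑ j ∈ range (m + 1), w j * Real.exp u ^ j) *
        (∑ k ∈ range (m + 1), w k * Real.exp (-u) ^ k) := by
  simp only [eval_finsetSum, eval_mul, eval_C, Polynomial.Chebyshev.T_real_cosh]
  have hterm : ∀ j k : ℕ, w j * w k * Real.cosh ((((j : ℤ) - k : ℤ) : ℝ) * u) =
      ((w j * Real.exp u ^ j) * (w k * Real.exp (-u) ^ k) +
        (w k * Real.exp u ^ k) * (w j * Real.exp (-u) ^ j)) / 2 := by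
    intro j k
    rw [Real.cosh_eq, ← Real.exp_nat_mul, ← Real.exp_nat_mul, ← Real.exp_nat_mul,
      ← Real.exp_nat_mul]
    push_cast
    have e1 : Real.exp (((j : ℝ) - k) * u) = Real.exp (j * u) * Real.exp (k * -u) := by
      rw [← Real.exp_add]; ring_nf
    have e2 : Real.exp (-(((j : ℝ) - k) * u)) = Real.exp (k * u) * Real.exp (j * -u) := by
      rw [← Real.exp_add]; ring_nf
    rw [e1, e2]
    ring
  simp_rw [hterm]
  rw [sum_mul_sum]
  have hswap : ∑ j ∈ range (m + 1), ∑ k ∈ range (m + 1),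
      (w k * Real.exp u ^ k) * (w j * Real.exp (-u) ^ j) =
      ∑ j ∈ range (m + 1), ∑ k ∈ range (m + 1),
      (w j * Real.exp u ^ j) * (w k * Real.exp (-u) ^ k) := by
    rw [sum_comm]
  simp_rw [← sum_div, sum_add_distrib]
  rw [hswap]
  ring

/-- `Q_w` has degree at most `m`. -/
theorem natDegree_sqPoly_le (w : ℕ → ℝ) (m : ℕ) :
    (∑ j ∈ range (m + 1), ∑ k ∈ range (m + 1),
        C (w j * w k) * Chebyshev.T ℝ ((j : ℤ) - k)).natDegree ≤ m := by
  refine natDegree_sum_le_of_forall_le _ _ fun j hj => ?_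
  refine natDegree_sum_le_of_forall_le _ _ fun k hk => ?_
  refine (natDegree_C_mul_le _ _).trans ?_
  rw [Polynomial.Chebyshev.natDegree_T]
  simp only [mem_range] at hj hk
  omega

/-- `Q_w(cosh u) ≥ 0` when the weights are nonnegative. -/
theorem eval_cosh_sqPoly_nonneg (w : ℕ → ℝ) (hw : ∀ j, 0 ≤ w j) (m : ℕ) (u : ℝ) :
    0 ≤ (∑ j ∈ range (m + 1), ∑ k ∈ range (m + 1),
        C (w j * w k) * Chebyshev.T ℝ ((j : ℤ) - k)).eval (Real.cosh u) := by
  rw [eval_cosh_sqPoly]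
  refine mul_nonneg (sum_nonneg fun j _ => ?_) (sum_nonneg fun k _ => ?_)
  · exact mul_nonneg (hw j) (pow_nonneg (Real.exp_pos _).le _)
  · exact mul_nonneg (hw k) (pow_nonneg (Real.exp_pos _).le _)

/-! ### Geometry of the substitution -/

/-- With `ρ = (1-√ε)/(1+√ε)` and `y = (1+ε-2s)/(1-ε)`: `1 - 2ρy + ρ² = 4s/(1+√ε)²`. -/
theorem one_sub_two_mul_rho {ε : ℝ} (hε0 : 0 < ε) (hε1 : ε < 1) (s : ℝ) :
    1 - 2 * ((1 - Real.sqrt ε) / (1 + Real.sqrt ε)) * ((1 + ε - 2 * s) / (1 - ε)) +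
        ((1 - Real.sqrt ε) / (1 + Real.sqrt ε)) ^ 2 =
      4 * s / (1 + Real.sqrt ε) ^ 2 := by
  have hr : 0 < Real.sqrt ε := Real.sqrt_pos.mpr hε0
  have hr1 : Real.sqrt ε < 1 := by
    rw [show (1 : ℝ) = Real.sqrt 1 by simp]; exact Real.sqrt_lt_sqrt hε0.le hε1
  have hsq : Real.sqrt ε ^ 2 = ε := Real.sq_sqrt hε0.le
  have h1 : (1 + Real.sqrt ε) ≠ 0 := by positivity
  have h2 : (1 - ε) ≠ 0 := by linarith
  have h3 : 1 - ε = (1 - Real.sqrt ε) * (1 + Real.sqrt ε) := by nlinarith [hsq]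
  rw [h3]
  have h4 : (1 - Real.sqrt ε) ≠ 0 := by linarith
  field_simp
  nlinarith [hsq]

/-- `0 ≤ ρ < 1` for `ρ = (1-√ε)/(1+√ε)`, `0 < ε < 1`; also `ρ ≤ 1 - √ε`. -/
theorem rho_bounds {ε : ℝ} (hε0 : 0 < ε) (hε1 : ε < 1) :
    0 ≤ (1 - Real.sqrt ε) / (1 + Real.sqrt ε) ∧ (1 - Real.sqrt ε) / (1 + Real.sqrt ε) < 1 ∧
      (1 - Real.sqrt ε) / (1 + Real.sqrt ε) ≤ 1 - Real.sqrt ε := by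
  have hr : 0 < Real.sqrt ε := Real.sqrt_pos.mpr hε0
  have hr1 : Real.sqrt ε < 1 := by
    rw [show (1 : ℝ) = Real.sqrt 1 by simp]; exact Real.sqrt_lt_sqrt hε0.le hε1
  have hpos : 0 < 1 + Real.sqrt ε := by positivity
  refine ⟨div_nonneg (by linarith) hpos.le, ?_, ?_⟩
  · rw [div_lt_one hpos]; linarith
  · rw [div_le_iff₀ hpos]; nlinarith

/-- `‖ρ e^{iθ}‖ = ρ` for `ρ ≥ 0`. -/
theorem norm_rho_exp {ρ : ℝ} (hρ : 0 ≤ ρ) (θ : ℝ) : ‖(ρ : ℂ) * exp (θ * I)‖ = ρ := by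
  rw [norm_mul, Complex.norm_exp_ofReal_mul_I, mul_one, norm_real, Real.norm_of_nonneg hρ]

/-- `‖1 - ρ e^{iθ}‖² = 1 - 2ρ cos θ + ρ²`. -/
theorem norm_one_sub_rho_exp_sq (ρ θ : ℝ) :
    ‖1 - (ρ : ℂ) * exp (θ * I)‖ ^ 2 = 1 - 2 * ρ * Real.cos θ + ρ ^ 2 := by
  rw [Complex.sq_norm, Complex.normSq_apply]
  simp only [sub_re, one_re, sub_im, one_im, Complex.re_ofReal_mul, Complex.im_ofReal_mul,
    Complex.exp_ofReal_mul_I_re, Complex.exp_ofReal_mul_I_im]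
  nlinarith [Real.cos_sq_add_sin_sq θ]

/-- `(1 - ρ e^u)(1 - ρ e^{-u}) = 1 - 2ρ cosh u + ρ²`. -/
theorem one_sub_rho_exp_mul (ρ u : ℝ) :
    (1 - ρ * Real.exp u) * (1 - ρ * Real.exp (-u)) = 1 - 2 * ρ * Real.cosh u + ρ ^ 2 := by
  rw [Real.cosh_eq]
  have h : Real.exp u * Real.exp (-u) = 1 := by rw [← Real.exp_add]; simp
  nlinarith [h]

/-- `(ρ e^{iθ})^j = ρ^j e^{ijθ}`, matching the weights `w_j = b_j ρ^j`:
`(b_j ρ^j : ℂ) e^{ijθ} = b_j (ρ e^{iθ})^j`. -/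
theorem weight_mul_exp_pow (b : ℕ → ℝ) (ρ θ : ℝ) (j : ℕ) :
    ((b j * ρ ^ j : ℝ) : ℂ) * exp (θ * I) ^ j = (b j : ℂ) * ((ρ : ℂ) * exp (θ * I)) ^ j := by
  push_cast
  ring

end Summit.QuantumFields.QCD.Theorems.MultibosonBridge.AdmissibleRoots

end
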